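import Mathlib
import Summits.AnomalousDissipation.AnomalousDissipation.Theses.LimitingAbsorption
import Summits.AnomalousDissipation.AnomalousDissipation.Theorems.LimitingAbsorptionFloorUpgradeStubCosTransformNonneg
import Summits.AnomalousDissipation.AnomalousDissipation.Theorems.LimitingAbsorptionFloorUpgradeStubCosTransformSumRule
import Summits.AnomalousDissipation.AnomalousDissipation.Theorems.LimitingAbsorptionFloorUpgradeStubCosTransformInversion
import Summits.AnomalousDissipation.AnomalousDissipation.Theorems.LimitingAbsorptionFloorUpgradeStubZeroFrequencyFloorOfParts
import Summits.AnomalousDissipation.AnomalousDissipation.Theorems.LimitingAbsorptionFloorUpgradeStubBallistic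
import Summits.AnomalousDissipation.AnomalousDissipation.Theorems.LimitingAbsorptionFloorUpgradeStubReleasePSD
import Summits.AnomalousDissipation.AnomalousDissipation.Theorems.LimitingAbsorptionFloorUpgradeStubReleaseKernelContinuous
import Summits.AnomalousDissipation.AnomalousDissipation.Theorems.LimitingAbsorptionFloorUpgradeStubCorrPackage
import Summits.AnomalousDissipation.AnomalousDissipation.Theorems.LimitingAbsorptionFloorUpgradeStubPowerIdentity
import Summits.AnomalousDissipation.AnomalousDissipation.Theorems.FloorUpgrade.Negative.FastClassEmpty
import HarnessLib

/-!
# Crux `LimitingAbsorption.FloorUpgrade` (stmt-AnomalousDissipation-15010) — line `SketchIdeator1`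
# (idea `bochner-zero-frequency-floor`): lead skeleton, TERMINAL STATE (continuation lead c1)

State of the seven registered stubs (skeleton 998d2ae85941 of the first lead):

* LANDED (imported above, `--supports stmt-AnomalousDissipation-15010`):
  `stub_ballistic` (B1, p106207; also `Negative.ballistic_bound` p104131),
  `stub_releasePSD` (F1, p106932), `stub_releaseKernelContinuous` (F2, p107578),
  `stub_corrPackage` (F3, p108071), `stub_powerIdentity` (F4, p109576 + p111815), and the
  Bochner floor A1–A4 (`stub_cosTransform_nonneg` p97580, `stub_cosTransform_sumRule` p98849,
  `stub_cosTransform_inversion` p100399, `stub_zeroFrequencyFloor_of_parts` p102035).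
* `stub_fastFloorUpgrade` (assembly for FAST relaxing families, `256 C^{1/3} G² E ≤ γ² ‖h‖²`):
  DISCHARGED BELOW, but VACUOUSLY — its hypothesis class is EMPTY by the transport speed limit
  `7 γ² ‖h‖² ≤ 1440 C^{1/3} G² E` (`Negative.fastRelaxingFamily_false`, p105829, refuter
  cdisprove), so no floor mathematics is exercised.
* `stub_boost : RelaxingFamily → FAST` — the only remaining `sorry`; by the same emptiness it is
  EQUIVALENT to `¬ RelaxingFamily` (`stub_boost_iff_not_relaxingFamily` below, kernel-checked):
  the composition `stub_fastFloorUpgrade (stub_boost hR)` can close the crux only by refuting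
  the route's own crux r3. The line is therefore DEAD as a proof strategy for `FloorUpgrade`
  (see `Lines/SketchIdeator1.dead.md`); what survives is the kernel dictionary F1–F4, B1 and
  the abstract Bochner floor A1–A4 as `--supports` tools.

`FloorUpgrade_of` concludes `Summit.….Theses.LimitingAbsorption.FloorUpgrade` by name.
-/

set_option linter.dupNamespace false

noncomputable section

open MeasureTheory Set Filter Topology
open scoped BigOperators InnerProductSpace
open Summit.AnomalousDissipation.AnomalousDissipation.Theses.LimitingAbsorption

namespace Summit.AnomalousDissipation.AnomalousDissipation.Theorems.FloorUpgradeLine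

/-- **Assembly stub, discharged VACUOUSLY.** The FAST relaxing-family class (the registered
hypothesis `hfast`: `RelaxingFamily`'s data and clauses, jointly smooth divergence-free
velocities, `1 ≤ C`, a gradient bound `G`, an eventual Cesàro energy bound `E` and
`256 C^{1/3} G² E ≤ γ² ‖h‖²`) is EMPTY: `Negative.fastRelaxingFamily_false` (transport speed
limit `7 γ² ‖h‖² ≤ 1440 C^{1/3} G² E` for every relaxing family). Hence the implication holds with
nothing to prove — and carries no information about the absorbed-power floor. [folklore] -/
theorem stub_fastFloorUpgrade
    (hfast :
      ∃ (g : UnitAddTorus (Fin 2) → EuclideanSpace ℝ (Fin 2)) (h : UnitAddTorus (Fin 2) → ℝ), Literature.Analysis.FunctionSpaces.Torus.IsSmooth g ∧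
      Literature.Analysis.FunctionSpaces.Torus.IsDivFree g ∧
      Literature.Analysis.FunctionSpaces.Torus.HasZeroMean g ∧
      Literature.Analysis.FunctionSpaces.Torus.IsSmooth h ∧
      Literature.Analysis.FunctionSpaces.Torus.HasZeroMean h ∧ h ≠ 0 ∧
      ∃ (ν : ℕ → ℝ) (v₀ : ℕ → UnitAddTorus (Fin 2) → EuclideanSpace ℝ (Fin 2)) (v : ℕ → ℝ → UnitAddTorus (Fin 2) → EuclideanSpace ℝ (Fin 2)), (∀ j, 0 < ν j) ∧
      Filter.Tendsto ν Filter.atTop (nhds 0) ∧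
      (∀ j, Literature.Analysis.FluidPDE.Torus.IsGlobalLerayHopf (ν j) (fun _ => g) (v₀ j) (v j)) ∧
      (∀ j : ℕ, ∀ (T : ℝ), 0 < T → MeasureTheory.MemLp (Literature.Analysis.FunctionSpaces.Torus.stLift (v j)) ⊤ (MeasureTheory.volume.restrict (Set.Ioo (0 : ℝ) T ×ˢ Set.univ))) ∧
      (∀ j, Literature.Analysis.FunctionSpaces.Torus.IsSmoothSpaceTimeOn (Set.Ici (0 : ℝ)) (v j)) ∧
      (∀ j t, 0 ≤ t → Literature.Analysis.FunctionSpaces.Torus.IsDivFree (v j t)) ∧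
      ∃ E C γ G : ℝ, (∀ j, Literature.Analysis.FluidPDE.meanEnergy (v j) ≤ E) ∧
      (∀ j, ∀ᶠ T in Filter.atTop, Literature.Analysis.FluidPDE.timeMean (fun t => ∫ x, ‖v j t x‖ ^ 2) T ≤ E) ∧
      1 ≤ C ∧ 0 < γ ∧ (∀ x, ‖Literature.Analysis.FunctionSpaces.Torus.gradient h x‖ ≤ G) ∧
      256 * C ^ ((1 : ℝ) / 3) * G ^ 2 * E ≤ γ ^ 2 * Literature.Analysis.FluidPDE.Torus.scalarL2Sq h ∧
      ∀ (j : ℕ) (s : ℝ), 0 ≤ s → ∀ (T : ℝ) (θ : ℝ → UnitAddTorus (Fin 2) → ℝ), Literature.Analysis.FluidPDE.Torus.IsWeakScalarTransportOn T (ν j) (fun t => v j (s + t)) h θ → ∀ᵐ t ∂(MeasureTheory.volume.restrict (Set.Ioo (0 : ℝ) T)), Literature.Analysis.FluidPDE.Torus.scalarL2Sq (θ t) ≤ C * Real.exp (-(γ * t)) * Literature.Analysis.FluidPDE.Torus.scalarL2Sq h) :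
    UniformRelaxationWitness := by
  refine absurd ?_ FloorUpgrade.Negative.fastRelaxingFamily_false
  obtain ⟨g, h, hg, hgd, hgm, hh, hhm, hne, ν, v₀, v, hν, hνlim, hLH, hbd, hsm, _hdiv, E, C, γ, G,
    hrest⟩ := hfast
  exact ⟨g, h, hg, hgd, hgm, hh, hhm, hne, ν, v₀, v, hν, hνlim, hLH, hbd, hsm, E, C, γ, G, hrest⟩

/-- **Residual stub (OPEN, and not closable inside the line): "a relaxing family may be taken
fast".** By `Negative.fastRelaxingFamily_false` its conclusion is an empty class, so this stub
is equivalent to `¬ RelaxingFamily` (`stub_boost_iff_not_relaxingFamily`): it cannot be obtained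
from `RelaxingFamily` by bookkeeping (time rescaling `v ↦ λv(λ·)`, `ν ↦ λν`, `g ↦ λ²g`,
`h ↦ ch`, sub-families, phase shifts and torus isometries all fix `C^{1/3} G² E/(γ² ‖h‖²)`), and
at the registered constant `256` not at all unless crux r3 is false. [folklore] -/
theorem stub_boost (hR : RelaxingFamily) :
      ∃ (g : UnitAddTorus (Fin 2) → EuclideanSpace ℝ (Fin 2)) (h : UnitAddTorus (Fin 2) → ℝ), Literature.Analysis.FunctionSpaces.Torus.IsSmooth g ∧
      Literature.Analysis.FunctionSpaces.Torus.IsDivFree g ∧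
      Literature.Analysis.FunctionSpaces.Torus.HasZeroMean g ∧
      Literature.Analysis.FunctionSpaces.Torus.IsSmooth h ∧
      Literature.Analysis.FunctionSpaces.Torus.HasZeroMean h ∧ h ≠ 0 ∧
      ∃ (ν : ℕ → ℝ) (v₀ : ℕ → UnitAddTorus (Fin 2) → EuclideanSpace ℝ (Fin 2)) (v : ℕ → ℝ → UnitAddTorus (Fin 2) → EuclideanSpace ℝ (Fin 2)), (∀ j, 0 < ν j) ∧
      Filter.Tendsto ν Filter.atTop (nhds 0) ∧
      (∀ j, Literature.Analysis.FluidPDE.Torus.IsGlobalLerayHopf (ν j) (fun _ => g) (v₀ j) (v j)) ∧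
      (∀ j : ℕ, ∀ (T : ℝ), 0 < T → MeasureTheory.MemLp (Literature.Analysis.FunctionSpaces.Torus.stLift (v j)) ⊤ (MeasureTheory.volume.restrict (Set.Ioo (0 : ℝ) T ×ˢ Set.univ))) ∧
      (∀ j, Literature.Analysis.FunctionSpaces.Torus.IsSmoothSpaceTimeOn (Set.Ici (0 : ℝ)) (v j)) ∧
      (∀ j t, 0 ≤ t → Literature.Analysis.FunctionSpaces.Torus.IsDivFree (v j t)) ∧
      ∃ E C γ G : ℝ, (∀ j, Literature.Analysis.FluidPDE.meanEnergy (v j) ≤ E) ∧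
      (∀ j, ∀ᶠ T in Filter.atTop, Literature.Analysis.FluidPDE.timeMean (fun t => ∫ x, ‖v j t x‖ ^ 2) T ≤ E) ∧
      1 ≤ C ∧ 0 < γ ∧ (∀ x, ‖Literature.Analysis.FunctionSpaces.Torus.gradient h x‖ ≤ G) ∧
      256 * C ^ ((1 : ℝ) / 3) * G ^ 2 * E ≤ γ ^ 2 * Literature.Analysis.FluidPDE.Torus.scalarL2Sq h ∧
      ∀ (j : ℕ) (s : ℝ), 0 ≤ s → ∀ (T : ℝ) (θ : ℝ → UnitAddTorus (Fin 2) → ℝ), Literature.Analysis.FluidPDE.Torus.IsWeakScalarTransportOn T (ν j) (fun t => v j (s + t)) h θ → ∀ᵐ t ∂(MeasureTheory.volume.restrict (Set.Ioo (0 : ℝ) T)), Literature.Analysis.FluidPDE.Torus.scalarL2Sq (θ t) ≤ C * Real.exp (-(γ * t)) * Literature.Analysis.FluidPDE.Torus.scalarL2Sq h := by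
  sorry

/-- **Why the line is dead (kernel-checked).** The residual stub `stub_boost`, as an
implication `RelaxingFamily → FAST`, is equivalent to the negation of the route's crux r3
`RelaxingFamily`, because the FAST class is empty (`Negative.fastRelaxingFamily_false`).
[folklore] -/
theorem stub_boost_iff_not_relaxingFamily :
    (RelaxingFamily →
      ∃ (g : UnitAddTorus (Fin 2) → EuclideanSpace ℝ (Fin 2)) (h : UnitAddTorus (Fin 2) → ℝ), Literature.Analysis.FunctionSpaces.Torus.IsSmooth g ∧
      Literature.Analysis.FunctionSpaces.Torus.IsDivFree g ∧
      Literature.Analysis.FunctionSpaces.Torus.HasZeroMean g ∧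
      Literature.Analysis.FunctionSpaces.Torus.IsSmooth h ∧
      Literature.Analysis.FunctionSpaces.Torus.HasZeroMean h ∧ h ≠ 0 ∧
      ∃ (ν : ℕ → ℝ) (v₀ : ℕ → UnitAddTorus (Fin 2) → EuclideanSpace ℝ (Fin 2)) (v : ℕ → ℝ → UnitAddTorus (Fin 2) → EuclideanSpace ℝ (Fin 2)), (∀ j, 0 < ν j) ∧
      Filter.Tendsto ν Filter.atTop (nhds 0) ∧
      (∀ j, Literature.Analysis.FluidPDE.Torus.IsGlobalLerayHopf (ν j) (fun _ => g) (v₀ j) (v j)) ∧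
      (∀ j : ℕ, ∀ (T : ℝ), 0 < T → MeasureTheory.MemLp (Literature.Analysis.FunctionSpaces.Torus.stLift (v j)) ⊤ (MeasureTheory.volume.restrict (Set.Ioo (0 : ℝ) T ×ˢ Set.univ))) ∧
      (∀ j, Literature.Analysis.FunctionSpaces.Torus.IsSmoothSpaceTimeOn (Set.Ici (0 : ℝ)) (v j)) ∧
      (∀ j t, 0 ≤ t → Literature.Analysis.FunctionSpaces.Torus.IsDivFree (v j t)) ∧
      ∃ E C γ G : ℝ, (∀ j, Literature.Analysis.FluidPDE.meanEnergy (v j) ≤ E) ∧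
      (∀ j, ∀ᶠ T in Filter.atTop, Literature.Analysis.FluidPDE.timeMean (fun t => ∫ x, ‖v j t x‖ ^ 2) T ≤ E) ∧
      1 ≤ C ∧ 0 < γ ∧ (∀ x, ‖Literature.Analysis.FunctionSpaces.Torus.gradient h x‖ ≤ G) ∧
      256 * C ^ ((1 : ℝ) / 3) * G ^ 2 * E ≤ γ ^ 2 * Literature.Analysis.FluidPDE.Torus.scalarL2Sq h ∧
      ∀ (j : ℕ) (s : ℝ), 0 ≤ s → ∀ (T : ℝ) (θ : ℝ → UnitAddTorus (Fin 2) → ℝ), Literature.Analysis.FluidPDE.Torus.IsWeakScalarTransportOn T (ν j) (fun t => v j (s + t)) h θ → ∀ᵐ t ∂(MeasureTheory.volume.restrict (Set.Ioo (0 : ℝ) T)), Literature.Analysis.FluidPDE.Torus.scalarL2Sq (θ t) ≤ C * Real.exp (-(γ * t)) * Literature.Analysis.FluidPDE.Torus.scalarL2Sq h) ↔ ¬ RelaxingFamily := by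
  constructor
  · intro hboost hR
    obtain ⟨g, h, hg, hgd, hgm, hh, hhm, hne, ν, v₀, v, hν, hνlim, hLH, hbd, hsm, _hdiv, E, C, γ, G,
      hrest⟩ := hboost hR
    exact FloorUpgrade.Negative.fastRelaxingFamily_false
      ⟨g, h, hg, hgd, hgm, hh, hhm, hne, ν, v₀, v, hν, hνlim, hLH, hbd, hsm, E, C, γ, G, hrest⟩
  · intro hnR hR
    exact (hnR hR).elim

/-- **The crux modulo the stubs**: `FloorUpgrade = RelaxingFamily → UniformRelaxationWitness`
as `stub_fastFloorUpgrade (stub_boost hR)`. With `stub_fastFloorUpgrade` vacuous this is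
`FloorUpgrade` from `¬ RelaxingFamily` in disguise (`stub_boost_iff_not_relaxingFamily`); the
landed dictionary (B1 `stub_ballistic`, F1 `stub_releasePSD`, F2 `stub_releaseKernelContinuous`,
F3 `stub_corrPackage`, F4 `stub_powerIdentity`, A1–A4 `zeroFrequencyFloor`) is referenced here
so the audit sees the line's parts. [folklore] -/
theorem FloorUpgrade_of : FloorUpgrade := by
  intro hR
  have _hA := @stub_zeroFrequencyFloor_of_parts
  have _hB := @stub_ballistic
  have _hF1 := @stub_releasePSD
  have _hF2 := @stub_releaseKernelContinuous
  have _hF3 := @stub_corrPackage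
  have _hF4 := @stub_powerIdentity
  exact stub_fastFloorUpgrade (stub_boost hR)

end Summit.AnomalousDissipation.AnomalousDissipation.Theorems.FloorUpgradeLine

end
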